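import Summits.FinalStateConjecture.FinalStateConjecture.Theses.PhaseMixingCapture

/-!
# The IVT wall obstruction to locally-uniform two-sided repair (drefute, stub `stub_repairUnfolding`)

Abstract core of the finding on STUB 4 of line `capture-exports-censorship-diagonal-surgery`
(crux `CaptureSuffices`, stmt-FinalStateConjecture-9953). Let `v : ℝ × ℝ → ℝ` be any CONTINUOUS
"wall function" on the parameter plane `(c, e)` of a two-parameter unfolding `G` (think:
`v (c, e) < 0` iff `G(c,e)` disperses, `> 0` iff it collapses to a sub-extremal hole, `= 0` iff it is
critical = censored non-settling, as along the extremal-critical-collapse families of Kehle–Unger,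
arXiv:2402.10190, Thm. 1 and Conj. 3/5). If the base family `c ↦ G(c,0) = F(c)` CROSSES the wall at
`c₁` (`v(·,0) < 0` just left of `c₁`, `> 0` just right of it), then there is NO threshold `ε > 0` such
that all kicks `0 < |e| < ε` of all members near `c₁` avoid the wall: for each small `e` the path
`c ↦ G(c,e)` still runs from the dispersing to the collapsing side, so it meets `v = 0` (intermediate
value theorem). This is exactly the negation of the local-repair clause
`∃ ε > 0, ∀ᶠ c in 𝓝 c₁, ∀ e ≠ 0, |e| < ε → Settles (G(c,e))` of STUB 4 at `c₀ = c₁`, for every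
unfolding that is continuous into a topology making `v` continuous (every "tame" kick family).
-/

open Set Filter Topology

-- the problem namespace `FinalStateConjecture.FinalStateConjecture` (single-conjunct summit) trips dupNamespace
set_option linter.dupNamespace false

namespace Summit.FinalStateConjecture.FinalStateConjecture.Theorems.CaptureSuffices.Negative

/-- **IVT wall lemma (interval form).** A continuous `v` on the `(c,e)`-plane whose restriction to
the axis `e = 0` is negative at `a` and positive at `b`, `a ≤ b`, vanishes at some `(c, e₀)` with
`c ∈ [a,b]` and `0 < e₀ < ε`, for every `ε > 0`. [folklore] -/
theorem exists_zero_of_sign_change {v : ℝ × ℝ → ℝ} (hv : Continuous v) {a b : ℝ} (hab : a ≤ b)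
    (hneg : v (a, 0) < 0) (hpos : 0 < v (b, 0)) {ε : ℝ} (hε : 0 < ε) :
    ∃ c ∈ Icc a b, ∃ e₀ : ℝ, 0 < e₀ ∧ e₀ < ε ∧ v (c, e₀) = 0 := by
  have hca : Continuous fun e : ℝ ↦ v (a, e) := hv.comp (continuous_const.prodMk continuous_id)
  have hcb : Continuous fun e : ℝ ↦ v (b, e) := hv.comp (continuous_const.prodMk continuous_id)
  have h1 : ∀ᶠ e in 𝓝 (0 : ℝ), v (a, e) < 0 := hca.continuousAt.eventually_lt continuousAt_const hneg
  have h2 : ∀ᶠ e in 𝓝 (0 : ℝ), 0 < v (b, e) := continuousAt_const.eventually_lt hcb.continuousAt hpos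
  have h3 : ∀ᶠ e in 𝓝 (0 : ℝ), e < ε := Iio_mem_nhds hε
  have h4 : ∀ᶠ e in 𝓝[>] (0 : ℝ), 0 < e := eventually_mem_nhdsWithin
  obtain ⟨e₀, ⟨he1, he2, he3⟩, he4⟩ :=
    (((h1.and (h2.and h3)).filter_mono nhdsWithin_le_nhds).and h4).exists
  have hcont : ContinuousOn (fun c : ℝ ↦ v (c, e₀)) (Icc a b) :=
    (hv.comp (continuous_id.prodMk continuous_const)).continuousOn
  obtain ⟨c, hc, hc0⟩ := intermediate_value_Icc hab hcont ⟨he1.le, he2.le⟩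
  exact ⟨c, hc, e₀, he4, he3, hc0⟩

/-- **IVT wall obstruction (the shape of STUB 4's repair clause).** If the base family crosses the
wall transversally at `c₁` — `v(c,0) < 0` for `c < c₁` near `c₁` and `v(c,0) > 0` for `c > c₁` near
`c₁` — then the locally-uniform two-sided repair clause fails at `c₁`: there is no `ε > 0` with
`v(c,e) ≠ 0` for all `c` near `c₁` and all `0 < |e| < ε`. [folklore] -/
theorem not_locallyUniformRepair_of_crossing {v : ℝ × ℝ → ℝ} (hv : Continuous v) {c₁ : ℝ}
    (hleft : ∀ᶠ c in 𝓝[<] c₁, v (c, 0) < 0) (hright : ∀ᶠ c in 𝓝[>] c₁, 0 < v (c, 0)) :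
    ¬ ∃ ε > (0 : ℝ), ∀ᶠ c in 𝓝 c₁, ∀ e : ℝ, e ≠ 0 → |e| < ε → v (c, e) ≠ 0 := by
  rintro ⟨ε, hε, hrep⟩
  -- a neighbourhood `(c₁ - r, c₁ + r)` on which the repair clause holds
  obtain ⟨r, hr, hball⟩ := Metric.eventually_nhds_iff.1 hrep
  -- a point `a < c₁` in it on the negative side, a point `b > c₁` in it on the positive side
  have hIoo_l : ∀ᶠ c in 𝓝[<] c₁, c₁ - r < c :=
    Ioo_mem_nhdsLT (sub_lt_self c₁ hr) |> mem_of_superset <| fun c hc ↦ hc.1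
  have hIoo_r : ∀ᶠ c in 𝓝[>] c₁, c < c₁ + r :=
    Ioo_mem_nhdsGT (lt_add_of_pos_right c₁ hr) |> mem_of_superset <| fun c hc ↦ hc.2
  have hlt_l : ∀ᶠ c in 𝓝[<] c₁, c < c₁ := eventually_mem_nhdsWithin
  have hlt_r : ∀ᶠ c in 𝓝[>] c₁, c₁ < c := eventually_mem_nhdsWithin
  obtain ⟨a, ha_neg, ha_r, ha_lt⟩ := (hleft.and (hIoo_l.and hlt_l)).exists
  obtain ⟨b, hb_pos, hb_r, hb_lt⟩ := (hright.and (hIoo_r.and hlt_r)).exists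
  obtain ⟨c, hc, e₀, he0, heε, hzero⟩ :=
    exists_zero_of_sign_change hv (ha_lt.le.trans hb_lt.le) ha_neg hb_pos hε
  have hcball : dist c c₁ < r := by
    rw [Real.dist_eq, abs_lt]
    constructor <;> linarith [hc.1, hc.2]
  exact hball hcball e₀ he0.ne' (by rwa [abs_of_pos he0]) hzero

/-- The same obstruction read on an abstract data space: `G : ℝ × ℝ → 𝔇` an unfolding continuous for
SOME topology on `𝔇` in which the wall function `w : 𝔇 → ℝ` is continuous (`w < 0` dispersing,
`w > 0` collapsing, `w = 0` critical non-settling). A transversal crossing of the wall by the base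
family `c ↦ G (c, 0)` at `c₁` kills the clause "all small kicks of all members near `c₁` settle",
whatever `G` does off the axis. [folklore] -/
theorem not_locallyUniformRepair_of_crossing' {𝔇 : Type*} [TopologicalSpace 𝔇]
    {G : ℝ × ℝ → 𝔇} (hG : Continuous G) {w : 𝔇 → ℝ} (hw : Continuous w)
    {Settles : 𝔇 → Prop} (hwall : ∀ D, Settles D → w D ≠ 0) {c₁ : ℝ}
    (hleft : ∀ᶠ c in 𝓝[<] c₁, w (G (c, 0)) < 0) (hright : ∀ᶠ c in 𝓝[>] c₁, 0 < w (G (c, 0))) :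
    ¬ ∃ ε > (0 : ℝ), ∀ᶠ c in 𝓝 c₁, ∀ e : ℝ, e ≠ 0 → |e| < ε → Settles (G (c, e)) := by
  rintro ⟨ε, hε, hrep⟩
  refine not_locallyUniformRepair_of_crossing (v := fun p ↦ w (G p)) (hw.comp hG) hleft hright
    ⟨ε, hε, hrep.mono fun c hc e he hlt ↦ hwall _ (hc e he hlt)⟩

/-- **IVT wall obstruction, separation form** (no wall FUNCTION needed): `B` ("collapses to a
sub-extremal hole") and `C` ("disperses") are disjoint OPEN sets of data for some topology in which
the unfolding `G` is continuous, every SETTLING datum lies in `B ∪ C` (critical data settle in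
neither sense), and the base family passes from `C` to `B` across `c₁`. Then the clause "all small
kicks of all members near `c₁` settle" fails: for small `e ≠ 0` the connected path `c ↦ G(c,e)` from
a `C`-member to a `B`-member cannot stay inside the disjoint open cover `B ∪ C`. [folklore] -/
theorem not_locallyUniformRepair_of_separation {𝔇 : Type*} [TopologicalSpace 𝔇]
    {G : ℝ × ℝ → 𝔇} (hG : Continuous G) {B C : Set 𝔇} (hB : IsOpen B) (hC : IsOpen C)
    (hBC : Disjoint B C) {Settles : 𝔇 → Prop} (hsettle : ∀ D, Settles D → D ∈ B ∪ C) {c₁ : ℝ}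
    (hleft : ∀ᶠ c in 𝓝[<] c₁, G (c, 0) ∈ C) (hright : ∀ᶠ c in 𝓝[>] c₁, G (c, 0) ∈ B) :
    ¬ ∃ ε > (0 : ℝ), ∀ᶠ c in 𝓝 c₁, ∀ e : ℝ, e ≠ 0 → |e| < ε → Settles (G (c, e)) := by
  rintro ⟨ε, hε, hrep⟩
  obtain ⟨r, hr, hball⟩ := Metric.eventually_nhds_iff.1 hrep
  have hIoo_l : ∀ᶠ c in 𝓝[<] c₁, c₁ - r < c :=
    Ioo_mem_nhdsLT (sub_lt_self c₁ hr) |> mem_of_superset <| fun c hc ↦ hc.1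
  have hIoo_r : ∀ᶠ c in 𝓝[>] c₁, c < c₁ + r :=
    Ioo_mem_nhdsGT (lt_add_of_pos_right c₁ hr) |> mem_of_superset <| fun c hc ↦ hc.2
  have hlt_l : ∀ᶠ c in 𝓝[<] c₁, c < c₁ := eventually_mem_nhdsWithin
  have hlt_r : ∀ᶠ c in 𝓝[>] c₁, c₁ < c := eventually_mem_nhdsWithin
  obtain ⟨a, ha_C, ha_r, ha_lt⟩ := (hleft.and (hIoo_l.and hlt_l)).exists
  obtain ⟨b, hb_B, hb_r, hb_lt⟩ := (hright.and (hIoo_r.and hlt_r)).exists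
  -- a small `e₀ ∈ (0, ε)` with `G (a, e₀) ∈ C` and `G (b, e₀) ∈ B` (openness + continuity in `e`)
  have hca : Continuous fun e : ℝ ↦ G (a, e) := hG.comp (continuous_const.prodMk continuous_id)
  have hcb : Continuous fun e : ℝ ↦ G (b, e) := hG.comp (continuous_const.prodMk continuous_id)
  have h1 : ∀ᶠ e in 𝓝 (0 : ℝ), G (a, e) ∈ C := hca.continuousAt.eventually_mem (hC.mem_nhds ha_C)
  have h2 : ∀ᶠ e in 𝓝 (0 : ℝ), G (b, e) ∈ B := hcb.continuousAt.eventually_mem (hB.mem_nhds hb_B)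
  have h3 : ∀ᶠ e in 𝓝 (0 : ℝ), e < ε := Iio_mem_nhds hε
  have h4 : ∀ᶠ e in 𝓝[>] (0 : ℝ), 0 < e := eventually_mem_nhdsWithin
  obtain ⟨e₀, ⟨he1, he2, he3⟩, he4⟩ :=
    (((h1.and (h2.and h3)).filter_mono nhdsWithin_le_nhds).and h4).exists
  -- every member of the path `c ↦ G (c, e₀)`, `c ∈ [a, b]`, settles, hence lies in `B ∪ C`
  have hab : a ≤ b := ha_lt.le.trans hb_lt.le
  have hpath : ∀ c ∈ Icc a b, G (c, e₀) ∈ B ∪ C := by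
    intro c hc
    refine hsettle _ (hball ?_ e₀ he4.ne' (by rwa [abs_of_pos he4]))
    rw [Real.dist_eq, abs_lt]
    constructor <;> linarith [hc.1, hc.2]
  -- connectedness of `[a, b]` under the continuous path contradicts the disjoint open cover
  have hγ : Continuous fun c : ℝ ↦ G (c, e₀) := hG.comp (continuous_id.prodMk continuous_const)
  have hpre : IsPreconnected ((fun c : ℝ ↦ G (c, e₀)) '' Icc a b) :=
    isPreconnected_Icc.image _ hγ.continuousOn
  have hsub : (fun c : ℝ ↦ G (c, e₀)) '' Icc a b ⊆ B ∪ C := by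
    rintro _ ⟨c, hc, rfl⟩
    exact hpath c hc
  have hmeetB : ((fun c : ℝ ↦ G (c, e₀)) '' Icc a b ∩ B).Nonempty :=
    ⟨G (b, e₀), ⟨b, right_mem_Icc.2 hab, rfl⟩, he2⟩
  have hmeetC : ((fun c : ℝ ↦ G (c, e₀)) '' Icc a b ∩ C).Nonempty :=
    ⟨G (a, e₀), ⟨a, left_mem_Icc.2 hab, rfl⟩, he1⟩
  obtain ⟨D, -, hDB, hDC⟩ := hpre B C hB hC hsub hmeetB hmeetC
  exact hBC.le_bot ⟨hDB, hDC⟩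

end Summit.FinalStateConjecture.FinalStateConjecture.Theorems.CaptureSuffices.Negative
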